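import Literature.NumberTheory.DiophantineGeometry.GLHighestWeightDominanceProofs
import HarnessLib

/-!
# Highest weights of polynomial representations of `GL_n` are polynomial weights
# (discharge of `isPolynomial_of_hasHighestWeight`)

`GLHighestWeight.lean` records as a named fact (`def isPolynomial_of_hasHighestWeight : Prop`)
the statement: over a field of characteristic zero, every highest weight `χ` (the weight of a
nonzero `B`-semi-invariant vector, `HasHighestWeight ρ χ`, `B` the upper triangular Borel
subgroup) of a finite-dimensional *polynomial* representation `ρ` of `GL σ k`
(`IsPolynomialRep`: all matrix coefficients `g ↦ φ (ρ g v)` are polynomials in the entries of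
`g`) is a *polynomial weight* (`Weight.IsPolynomial`): dominant, `χ_i ≥ χ_j` for `i ≤ j`, with
nonnegative entries. This file PROVES it, in fact over any infinite field and without
finite-dimensionality (`isPolynomial_of_mem_highestWeightSpace`), and derives

* `Literature.NumberTheory.DiophantineGeometry.isPolynomial_of_hasHighestWeight_holds :
  isPolynomial_of_hasHighestWeight`.

## Source and proof

J. A. Green, *Polynomial Representations of `GL_n`*, LNM 830 (1980): §3.2 (a polynomial
`GL_n(K)`-module `V ∈ M_K(n, r)`, `K` infinite, is the direct sum of its weight spaces `V^α`,
`α ∈ Λ(n, r)` — the weights are compositions of `r` into `n` parts, in particular nonnegative)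
and Thm. (3.5a) (the irreducible modules in `M_K(n, r)` are indexed by the dominant weights
`Λ⁺(n, r)`, the partitions of `r` into at most `n` parts). [GreenLNM830] Green's route goes
through the Schur algebra `S_K(n, r)` and formal characters (§3.4); the vendored statement
concerns an arbitrary `B`-semi-invariant vector of an arbitrary (not necessarily irreducible or
homogeneous) polynomial representation, and is assembled here from two elementary facts:

* **Dominance** is already in the tree for *rational* representations over an infinite field:
  `isDominant_of_mem_highestWeightSpace` (file `GLHighestWeightDominanceProofs`, the rank-one
  argument in the `GL₂ ⊂ GL_σ` at a pair `i < j`; Goodman–Wallach Cor. 3.2.3), and a polynomial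
  representation is rational (`IsPolynomialRep.isRationalRep`).
* **Nonnegativity** (`apply_nonneg_of_mem_weightSpace`, proved here, for every torus weight
  vector — Green's `Λ(n, r) ⊆ ℕⁿ`). Let `v ≠ 0` satisfy `ρ t v = χ(t) v` for diagonal `t`, choose
  a linear form `φ` with `φ v ≠ 0` (`Module.Projective.exists_dual_ne_zero`), and let `Q` be the
  polynomial with `φ (ρ g v) = Q(g)` (`IsPolynomialRep`). Along the torus curve
  `t(s) = diag(1, …, s, …, 1)` (`s ≠ 0` at position `l`; `torusElt` of `OrbitClosureWeights`),
  `φ (ρ (t s) v) = s^{χ_l} φ v` is the value at `s` of the univariate polynomial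
  `G = Q ∘ (diagonal curve)` (`eval_diagCurve`, `eval_aeval_curve`). If `χ_l = -n < 0` this reads
  `G(s) sⁿ = φ v` for all `s ≠ 0`, and over an infinite field such an identity forces the constant
  `φ v` to vanish (`Polynomial.eval_zero_eq_zero_of_mul_pow_eq_eval_inv` of `OrbitClosureWeights`,
  with the constant polynomial `ψ = C (φ v)`) — a contradiction. This is Green's remark that the
  coefficient functions of a polynomial representation restricted to the diagonal torus are
  polynomials in `t₁, …, t_n`, so only monomials with exponents in `ℕⁿ` occur (§3.2).

## References

* J. A. Green, *Polynomial Representations of `GL_n`*, Lecture Notes in Mathematics 830,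
  Springer (1980), §3.2, §3.4, Thm. (3.5a). doi:10.1007/BFb0092296. [GreenLNM830]
* R. Goodman, N. R. Wallach, *Symmetry, Representations, and Invariants*, GTM 255, Springer
  (2009), Cor. 3.2.3 with Prop. 3.1.20 (1). [GoodmanWallachGTM255]
* W. Fulton, J. Harris, *Representation Theory. A First Course*, GTM 129 (1991), §15.5
  (polynomial irreducibles of `GL_nℂ` ↔ `λ₁ ≥ ⋯ ≥ λ_n ≥ 0`). [FultonHarrisGTM129]

## Reused from the tree

`GLHighestWeight`: `IsDiagonalGL.isUpperTriangular`, `weightChar`, `highestWeightSpace`,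
`HasHighestWeight`, `hasHighestWeight_iff_exists`, `IsPolynomialRep`,
`IsPolynomialRep.isRationalRep`, `Weight.IsPolynomial`, `isPolynomial_of_hasHighestWeight` (the
named fact). `GLHighestWeightDominanceProofs`: `isDominant_of_mem_highestWeightSpace`.
`OrbitClosureWeights` (`namespace Literature.Computability.AlgebraicComplexity`): `torusElt`,
`coe_torusElt`, `isDiagonalGL_torusElt`, `weightChar_torusElt`,
`Polynomial.eval_zero_eq_zero_of_mul_pow_eq_eval_inv`.
Mathlib: `Module.Projective.exists_dual_ne_zero`, `MvPolynomial.comp_aeval`,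
`MvPolynomial.aeval_eq_eval`, `Polynomial.coe_aeval_eq_eval`, `Pi.mulSingle`, `CharZero.infinite`.
Nothing is restated; the statement file `GLHighestWeight.lean` is untouched (the proof cannot
live there: `OrbitClosureWeights` imports it).
-/

noncomputable section

open scoped BigOperators Matrix MatrixGroups
open MvPolynomial Matrix

namespace Literature.NumberTheory.DiophantineGeometry

open Literature.Computability.AlgebraicComplexity

variable {σ : Type*} [Fintype σ] [LinearOrder σ] {k : Type*} [Field k]
  {V : Type*} [AddCommGroup V] [Module k V]

/-! ### Matrix coefficients along polynomial curves -/

section Curves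

omit [Fintype σ] [LinearOrder σ] in
/-- A polynomial in the matrix entries, restricted to a curve `s ↦ (c_{ij}(s))` of matrices with
polynomial entries, is the univariate polynomial `aeval c P`: `(aeval c P)(s) = P(c(s))`.
[folklore] -/
theorem eval_aeval_curve (P : MvPolynomial (σ × σ) k) (c : σ × σ → Polynomial k) (s : k) :
    (aeval c P).eval s = eval (fun ij : σ × σ => (c ij).eval s) P := by
  rw [← Polynomial.coe_aeval_eq_eval, ← AlgHom.comp_apply, comp_aeval]
  simp only [MvPolynomial.aeval_eq_eval, Polynomial.coe_aeval_eq_eval]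

end Curves

/-! ### Nonnegativity: the torus curve `diag(1, …, s, …, 1)` -/

section Nonneg

omit [Fintype σ] in
/-- The diagonal curve `s ↦ diag(1, …, s, …, 1)` (`s` at position `l`) as a matrix of
polynomials — `X` at `(l, l)`, `1` on the rest of the diagonal, `0` off the diagonal — evaluates
at `s` to the entries of `diagonal (mulSingle l s)`. [folklore] -/
theorem eval_diagCurve (l : σ) (s : k) (ij : σ × σ) :
    (if ij.1 = ij.2 then (if ij.1 = l then (Polynomial.X : Polynomial k) else 1) else 0).eval s =
      diagonal (Pi.mulSingle l s : σ → k) ij.1 ij.2 := by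
  rcases ij with ⟨a, b⟩
  by_cases hab : a = b
  · subst hab
    by_cases hal : a = l
    · subst hal; simp
    · simp [hal]
  · simp [hab]

omit [Fintype σ] in
/-- `mulSingle l s` has no zero entry for `s ≠ 0`. [folklore] -/
theorem mulSingle_apply_ne_zero (l : σ) {s : k} (hs : s ≠ 0) (i : σ) :
    (Pi.mulSingle l s : σ → k) i ≠ 0 := by
  by_cases h : i = l
  · subst h; simpa using hs
  · simp [h]

/-- The weight character at `diag(1, …, s, …, 1)` is `s^{χ_l}`. [folklore] -/
theorem weightChar_torusElt_mulSingle (χ : Weight σ) (l : σ) {s : k} (hs : s ≠ 0) :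
    weightChar χ (torusElt (Pi.mulSingle l s : σ → k) (mulSingle_apply_ne_zero l hs)) =
      s ^ χ l := by
  rw [weightChar_torusElt, Finset.prod_eq_single l]
  · simp
  · intro i _ hil
    simp [hil]
  · intro h
    exact absurd (Finset.mem_univ l) h

/-- **Torus weights of a polynomial representation are nonnegative** (any infinite field): if
`v ≠ 0` satisfies `ρ t v = χ(t) v` for all diagonal `t` and the matrix coefficients of `ρ` are
polynomials, then `χ_l ≥ 0` for every `l` — the coefficient
`s ↦ φ (ρ (diag(1, …, s, …, 1)) v) = s^{χ_l} φ v` is a polynomial in `s`. Green, LNM 830, §3.2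
(the weights of `V ∈ M_K(n, r)` lie in `Λ(n, r) ⊆ ℕⁿ`: the coefficient functions restricted to
the diagonal torus are polynomials in `t₁, …, t_n`). [cite: GreenLNM830, §3.2] -/
theorem apply_nonneg_of_mem_weightSpace [Infinite k] {ρ : Representation k (GL σ k) V}
    (hpol : IsPolynomialRep ρ) {χ : Weight σ} {v : V} (hv : v ∈ weightSpace ρ χ)
    (hv0 : v ≠ 0) (l : σ) : 0 ≤ χ l := by
  obtain ⟨φ, hφ⟩ := Module.Projective.exists_dual_ne_zero k hv0
  obtain ⟨Q, hQ⟩ := hpol v φ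
  by_contra hcon
  push Not at hcon
  -- `n = -χ l ≥ 1`
  obtain ⟨n, hn1, hn⟩ : ∃ n : ℕ, 1 ≤ n ∧ (-χ l : ℤ) = n :=
    ⟨(-χ l).toNat, by omega, (Int.toNat_of_nonneg (by omega)).symm⟩
  -- the matrix coefficient along the torus curve, a polynomial in `s`
  set G : Polynomial k := aeval (fun ij : σ × σ =>
    if ij.1 = ij.2 then (if ij.1 = l then (Polynomial.X : Polynomial k) else 1) else 0) Q with hG
  have hGeval : ∀ s : k, s ≠ 0 → G.eval s = s ^ χ l * φ v := by
    intro s hs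
    have h1 := hQ (torusElt (Pi.mulSingle l s : σ → k) (mulSingle_apply_ne_zero l hs))
    rw [hv _ (isDiagonalGL_torusElt _ _), map_smul, smul_eq_mul,
      weightChar_torusElt_mulSingle χ l hs, coe_torusElt] at h1
    rw [hG, eval_aeval_curve]
    simp only [eval_diagCurve]
    exact h1.symm
  -- `G(s) sⁿ = φ v` for `s ≠ 0`
  have key : ∀ s : k, s ≠ 0 → G.eval s * s ^ n = (Polynomial.C (φ v)).eval s⁻¹ := by
    intro s hs
    rw [hGeval s hs, Polynomial.eval_C, mul_comm (s ^ χ l), mul_assoc, ← zpow_natCast, ← hn,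
      ← zpow_add₀ hs, add_neg_cancel, zpow_zero, mul_one]
  have h0 := Polynomial.eval_zero_eq_zero_of_mul_pow_eq_eval_inv hn1 key
  rw [Polynomial.eval_C] at h0
  exact hφ h0

/-- **Weights of `B`-semi-invariants of a polynomial representation are nonnegative** (any
infinite field): a `B`-semi-invariant vector is in particular a torus weight vector
(`highestWeightSpace_le_weightSpace`). Green, LNM 830, §3.2. [cite: GreenLNM830, §3.2] -/
theorem apply_nonneg_of_mem_highestWeightSpace [Infinite k] {ρ : Representation k (GL σ k) V}
    (hpol : IsPolynomialRep ρ) {χ : Weight σ} {v : V} (hv : v ∈ highestWeightSpace ρ χ)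
    (hv0 : v ≠ 0) (l : σ) : 0 ≤ χ l :=
  apply_nonneg_of_mem_weightSpace hpol (highestWeightSpace_le_weightSpace ρ χ hv) hv0 l

end Nonneg

/-! ### Assembly -/

section Assembly

/-- **Weights of `B`-semi-invariants of a polynomial representation are polynomial weights**
(any infinite field, no finite-dimensionality): dominant (`isDominant_of_mem_highestWeightSpace`,
as a polynomial representation is rational) with nonnegative entries
(`apply_nonneg_of_mem_highestWeightSpace`). Green, LNM 830, §3.2 with Thm. (3.5a).
[cite: GreenLNM830, Thm. 3.5a with §3.2] -/
theorem isPolynomial_of_mem_highestWeightSpace [Infinite k] {ρ : Representation k (GL σ k) V}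
    (hpol : IsPolynomialRep ρ) {χ : Weight σ} {v : V} (hv : v ∈ highestWeightSpace ρ χ)
    (hv0 : v ≠ 0) : χ.IsPolynomial :=
  ⟨isDominant_of_mem_highestWeightSpace hpol.isRationalRep hv hv0,
    fun l => apply_nonneg_of_mem_highestWeightSpace hpol hv hv0 l⟩

/-- **Highest weights of a polynomial representation are polynomial weights** (any infinite
field): if `ρ` is polynomial and has the highest weight `χ`, then `χ` is dominant and
nonnegative. Green, LNM 830, §3.2 with Thm. (3.5a). [cite: GreenLNM830, Thm. 3.5a with §3.2] -/
theorem isPolynomial_of_hasHighestWeight_of_infinite [Infinite k]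
    {ρ : Representation k (GL σ k) V} (hpol : IsPolynomialRep ρ) {χ : Weight σ}
    (h : HasHighestWeight ρ χ) : χ.IsPolynomial := by
  obtain ⟨v, hv0, hv⟩ := (hasHighestWeight_iff_exists _ _).mp h
  exact isPolynomial_of_mem_highestWeightSpace hpol hv hv0

/-- **Discharge of `isPolynomial_of_hasHighestWeight`** (`GLHighestWeight.lean`): over a field of
characteristic zero (hence infinite, `CharZero.infinite`), the highest weights of a
finite-dimensional polynomial representation of `GL σ k` are polynomial weights (dominant,
nonnegative entries); finite-dimensionality is not used. Green, LNM 830, §3.2 (weights of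
polynomial modules lie in `Λ(n, r)`) with Thm. (3.5a) (irreducible polynomial representations
↔ `Λ⁺(n, r)`). [cite: GreenLNM830, Thm. 3.5a with §3.2] -/
theorem isPolynomial_of_hasHighestWeight_holds :
    isPolynomial_of_hasHighestWeight (σ := σ) (k := k) (V := V) := by
  intro _ _ ρ hpol χ h
  haveI : Infinite k := CharZero.infinite k
  exact isPolynomial_of_hasHighestWeight_of_infinite hpol h

end Assembly

end Literature.NumberTheory.DiophantineGeometry
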